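import Summits.NavierStokesRegularity.NavierStokesRegularity.Theses.OddMorawetz
import Summits.NavierStokesRegularity.NavierStokesRegularity.Theorems.OddMorawetzMorawetzKillsTypeIReflectJet
import Summits.NavierStokesRegularity.NavierStokesRegularity.Theorems.OddMorawetzMorawetzKillsTypeIReflectDivFree
import Summits.NavierStokesRegularity.NavierStokesRegularity.Theorems.OddMorawetzMorawetzKillsTypeIReflectEulerBilinear
import Summits.NavierStokesRegularity.NavierStokesRegularity.Theorems.OddMorawetzMorawetzKillsTypeIWeightParity
import Literature.Analysis.FluidPDE.TaoAveragedEulerContDiff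

/-!
# Route OddMorawetz — crux `OddMorawetzLocal` (stmt-NavierStokesRegularity-1376): the parity obstruction

Negative knowledge for the hunt (`Theorems/OddMorawetzLocal/Negative/`). The crux asks for a derivative weight
`k ≤ 5` and a smooth density `m` on 3-jets which is a cubic form (`m(μz) = μ³ m(z)` for all real `μ`) of weight `k`
(`m(z₀, s z₁, s² z₂, s³ z₃) = sᵏ m(z)` for `s > 0`), whose Euler derivative `Q_m(v) = -∫ Dm(Jv)[J B(v,v)]`
(`B = eulerBilinear`, pressure included) is `≥ 0` on all divergence-free Schwartz fields and `> 0` on one.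

**Theorem (parity).** Let `P v (x) := -v(-x)`. Then `P` preserves divergence-free Schwartz fields,
`B(Pv, Pv) = P B(v, v)`, the 3-jet transforms by the sign twist `J(Pv)(x) = S Jv(-x)`,
`S(z₀, z₁, z₂, z₃) = (-z₀, z₁, -z₂, z₃)`, and every admissible density satisfies `m ∘ S = (-1)^{k+1} m`;
consequently `Q_m(Pv) = (-1)^{k+1} Q_m(v)` (`integral_parity`), and a witness of EVEN weight is impossible
(`odd_of_witness`): `Q_m ≥ 0` everywhere and `Q_m(v₀) > 0` would give `0 ≤ Q_m(Pv₀) = -Q_m(v₀) < 0`.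

* `oddMorawetzLocal_iff_odd` — `OddMorawetzLocal ↔` the same statement with `Odd k` added (so `k ∈ {1,3,5}`);
* `not_oddMorawetzLocal_iff` — the negative form: a refutation of the crux needs no work at even weight.

The pointwise ingredients (jets, divergence, `eulerBilinear` under the reflection, and the weight-parity identity
`m(z₀,-z₁,z₂,-z₃) = (-1)ᵏ m(z)`) are the landed stubs of the sibling crux `MorawetzKillsTypeI`
(`Theorems.stub_reflect_jet`, `stub_reflect_divFree`, `stub_reflect_eulerBilinear`, `stub_weightParity`), reused here;
this file adds the Schwartz stability, the functional identity and the crux-level consequences. Everything is proved;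
no definitions, no named facts.

## References
* T. Tao, *Finite time blowup for an averaged three-dimensional Navier–Stokes equation*, JAMS 29 (2016), §1.1
  (the Euler bilinear operator `B`, its symmetries).
* Route file `Theses/OddMorawetz.lean`, item docstring of `OddMorawetzLocal` ("k even … unsigned by parity").
-/

noncomputable section

open MeasureTheory
open Literature.Analysis Literature.Analysis.FluidPDE

set_option linter.dupNamespace false

namespace Summit.NavierStokesRegularity.NavierStokesRegularity.Theorems
namespace OddMorawetzParity

local notation "E3" => EuclideanSpace ℝ (Fin 3)
local notation "Jet" => EuclideanSpace ℝ (Fin 3) × (EuclideanSpace ℝ (Fin 3) [×1]→L[ℝ] EuclideanSpace ℝ (Fin 3)) ×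
  (EuclideanSpace ℝ (Fin 3) [×2]→L[ℝ] EuclideanSpace ℝ (Fin 3)) × (EuclideanSpace ℝ (Fin 3) [×3]→L[ℝ] EuclideanSpace ℝ (Fin 3))

/-- Schwartz fields are stable under the reflection `v ↦ -v(-·)`. -/
theorem isSchwartzField_parity {v : E3 → E3} (hv : IsSchwartzField v) : IsSchwartzField (fun x => -v (-x)) := by
  obtain ⟨f, hf⟩ := hv
  refine ⟨-(SchwartzMap.compCLMOfContinuousLinearEquiv ℝ (ContinuousLinearEquiv.neg ℝ) f), ?_⟩
  funext x
  simp [hf]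

/-- The 3-jet of the reflected field is the sign-twisted 3-jet at the reflected point:
`J(Pf)(x) = -(f, -Df, D²f, -D³f)(-x)`. -/
theorem jet_parity (f : E3 → E3) (x : E3) :
    ((-f (-x), iteratedFDeriv ℝ 1 (fun y => -f (-y)) x, iteratedFDeriv ℝ 2 (fun y => -f (-y)) x,
        iteratedFDeriv ℝ 3 (fun y => -f (-y)) x) : Jet) =
      -((f (-x), -iteratedFDeriv ℝ 1 f (-x), iteratedFDeriv ℝ 2 f (-x), -iteratedFDeriv ℝ 3 f (-x)) : Jet) := by
  rw [Theorems.stub_reflect_jet 1 f x, Theorems.stub_reflect_jet 2 f x, Theorems.stub_reflect_jet 3 f x]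
  ext <;> simp <;> norm_num

/-- The derivative of an admissible density along the sign twist: `Dm(Sz)[Sw] = (-1)^{k+1} Dm(z)[w]` for
`S(z₀,z₁,z₂,z₃) = -(z₀, -z₁, z₂, -z₃)` (chain rule through the linear map `S`, cubic homogeneity with `μ = -1`
and the weight parity `stub_weightParity`). -/
theorem fderiv_m_parity {m : Jet → ℝ} (hm : ContDiff ℝ (⊤ : ℕ∞) m)
    (hcub : ∀ (μ : ℝ) (z : Jet), m (μ • z) = μ ^ 3 * m z) {k : ℕ}
    (hwt : ∀ (s : ℝ), 0 < s → ∀ (z₀ : E3) (z₁ : E3 [×1]→L[ℝ] E3) (z₂ : E3 [×2]→L[ℝ] E3) (z₃ : E3 [×3]→L[ℝ] E3),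
      m (z₀, s • z₁, (s ^ 2) • z₂, (s ^ 3) • z₃) = s ^ k * m (z₀, z₁, z₂, z₃))
    (z₀ : E3) (z₁ : E3 [×1]→L[ℝ] E3) (z₂ : E3 [×2]→L[ℝ] E3) (z₃ : E3 [×3]→L[ℝ] E3)
    (w₀ : E3) (w₁ : E3 [×1]→L[ℝ] E3) (w₂ : E3 [×2]→L[ℝ] E3) (w₃ : E3 [×3]→L[ℝ] E3) :
    fderiv ℝ m (-((z₀, -z₁, z₂, -z₃) : Jet)) (-((w₀, -w₁, w₂, -w₃) : Jet)) =
      (-1) ^ (k + 1) * fderiv ℝ m (z₀, z₁, z₂, z₃) (w₀, w₁, w₂, w₃) := by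
  set S : Jet →L[ℝ] Jet := (-(ContinuousLinearMap.id ℝ E3)).prodMap
    ((ContinuousLinearMap.id ℝ (E3 [×1]→L[ℝ] E3)).prodMap ((-(ContinuousLinearMap.id ℝ (E3 [×2]→L[ℝ] E3))).prodMap
      (ContinuousLinearMap.id ℝ (E3 [×3]→L[ℝ] E3)))) with hS
  have hSz : ∀ z : Jet, S z = -((z.1, -z.2.1, z.2.2.1, -z.2.2.2) : Jet) := by
    rintro ⟨a, b, c, d⟩
    simp [hS, Prod.map]
  have hmS : m ∘ ⇑S = fun z => (-1) ^ (k + 1) * m z := by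
    funext z
    rw [Function.comp_apply, hSz, ← neg_one_smul ℝ ((z.1, -z.2.1, z.2.2.1, -z.2.2.2) : Jet), hcub,
      Theorems.stub_weightParity k m hm hcub hwt z.1 z.2.1 z.2.2.1 z.2.2.2]
    ring
  have hdiff : Differentiable ℝ m := hm.differentiable (by simp)
  have h1 : HasFDerivAt (m ∘ ⇑S) ((fderiv ℝ m (S (z₀, z₁, z₂, z₃))).comp S) (z₀, z₁, z₂, z₃) :=
    (hdiff _).hasFDerivAt.comp _ S.hasFDerivAt
  have h2 : HasFDerivAt (fun z : Jet => (-1) ^ (k + 1) * m z) (((-1 : ℝ) ^ (k + 1)) • fderiv ℝ m (z₀, z₁, z₂, z₃))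
      (z₀, z₁, z₂, z₃) := (hdiff _).hasFDerivAt.const_mul _
  rw [hmS] at h1
  have h3 := h1.unique h2
  have h4 := congrArg (fun L : Jet →L[ℝ] ℝ => L (w₀, w₁, w₂, w₃)) h3
  simp only [ContinuousLinearMap.comp_apply, smul_apply, smul_eq_mul] at h4
  rw [hSz, hSz] at h4
  exact h4

/-- **Parity of the Euler-derivative functional.** For an admissible density `m` of derivative weight `k` and a
Schwartz field `v`, `Q_m(Pv) = (-1)^{k+1} Q_m(v)` where `Pv(x) = -v(-x)` (stated for the integrals; `Q = -∫`). -/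
theorem integral_parity {m : Jet → ℝ} (hm : ContDiff ℝ (⊤ : ℕ∞) m)
    (hcub : ∀ (μ : ℝ) (z : Jet), m (μ • z) = μ ^ 3 * m z) {k : ℕ}
    (hwt : ∀ (s : ℝ), 0 < s → ∀ (z₀ : E3) (z₁ : E3 [×1]→L[ℝ] E3) (z₂ : E3 [×2]→L[ℝ] E3) (z₃ : E3 [×3]→L[ℝ] E3),
      m (z₀, s • z₁, (s ^ 2) • z₂, (s ^ 3) • z₃) = s ^ k * m (z₀, z₁, z₂, z₃))
    (v : E3 → E3) :
    (∫ x, fderiv ℝ m ((-v (-x), iteratedFDeriv ℝ 1 (fun y => -v (-y)) x, iteratedFDeriv ℝ 2 (fun y => -v (-y)) x,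
          iteratedFDeriv ℝ 3 (fun y => -v (-y)) x) : Jet)
        ((eulerBilinear (fun y => -v (-y)) (fun y => -v (-y)) x,
          iteratedFDeriv ℝ 1 (eulerBilinear (fun y => -v (-y)) (fun y => -v (-y))) x,
          iteratedFDeriv ℝ 2 (eulerBilinear (fun y => -v (-y)) (fun y => -v (-y))) x,
          iteratedFDeriv ℝ 3 (eulerBilinear (fun y => -v (-y)) (fun y => -v (-y))) x) : Jet)) =
      (-1) ^ (k + 1) * ∫ x, fderiv ℝ m ((v x, iteratedFDeriv ℝ 1 v x, iteratedFDeriv ℝ 2 v x, iteratedFDeriv ℝ 3 v x) : Jet)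
        ((eulerBilinear v v x, iteratedFDeriv ℝ 1 (eulerBilinear v v) x, iteratedFDeriv ℝ 2 (eulerBilinear v v) x,
          iteratedFDeriv ℝ 3 (eulerBilinear v v) x) : Jet) := by
  rw [Theorems.stub_reflect_eulerBilinear v]
  beta_reduce
  simp_rw [jet_parity, fderiv_m_parity hm hcub hwt]
  rw [integral_const_mul]
  congr 1
  have h := ((LinearIsometryEquiv.neg ℝ (E := E3)).measurePreserving).integral_comp
    (LinearIsometryEquiv.neg ℝ (E := E3)).toHomeomorph.measurableEmbedding
    (fun x => fderiv ℝ m ((v x, iteratedFDeriv ℝ 1 v x, iteratedFDeriv ℝ 2 v x, iteratedFDeriv ℝ 3 v x) : Jet)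
      ((eulerBilinear v v x, iteratedFDeriv ℝ 1 (eulerBilinear v v) x, iteratedFDeriv ℝ 2 (eulerBilinear v v) x,
        iteratedFDeriv ℝ 3 (eulerBilinear v v) x) : Jet))
  simpa only [LinearIsometryEquiv.coe_neg] using h

/-- **Odd weight is forced.** If an admissible density of weight `k` has `Q_m ≥ 0` on all divergence-free Schwartz
fields and `Q_m(v₀) > 0` on one of them, then `k` is odd: for even `k` the parity gives `Q_m(Pv₀) = -Q_m(v₀) < 0`. -/
theorem odd_of_witness {k : ℕ} {m : Jet → ℝ} (hm : ContDiff ℝ (⊤ : ℕ∞) m)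
    (hcub : ∀ (μ : ℝ) (z : Jet), m (μ • z) = μ ^ 3 * m z)
    (hwt : ∀ (s : ℝ), 0 < s → ∀ (z₀ : E3) (z₁ : E3 [×1]→L[ℝ] E3) (z₂ : E3 [×2]→L[ℝ] E3) (z₃ : E3 [×3]→L[ℝ] E3),
      m (z₀, s • z₁, (s ^ 2) • z₂, (s ^ 3) • z₃) = s ^ k * m (z₀, z₁, z₂, z₃))
    (hQ : ∀ v : E3 → E3, IsSchwartzField v → VectorCalculus.IsDivFree v →
      0 ≤ -∫ x, fderiv ℝ m ((v x, iteratedFDeriv ℝ 1 v x, iteratedFDeriv ℝ 2 v x, iteratedFDeriv ℝ 3 v x) : Jet)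
        ((eulerBilinear v v x, iteratedFDeriv ℝ 1 (eulerBilinear v v) x, iteratedFDeriv ℝ 2 (eulerBilinear v v) x,
          iteratedFDeriv ℝ 3 (eulerBilinear v v) x) : Jet))
    {v₀ : E3 → E3} (hv₀ : IsSchwartzField v₀) (hd₀ : VectorCalculus.IsDivFree v₀)
    (hpos : 0 < -∫ x, fderiv ℝ m ((v₀ x, iteratedFDeriv ℝ 1 v₀ x, iteratedFDeriv ℝ 2 v₀ x, iteratedFDeriv ℝ 3 v₀ x) : Jet)
        ((eulerBilinear v₀ v₀ x, iteratedFDeriv ℝ 1 (eulerBilinear v₀ v₀) x, iteratedFDeriv ℝ 2 (eulerBilinear v₀ v₀) x,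
          iteratedFDeriv ℝ 3 (eulerBilinear v₀ v₀) x) : Jet)) :
    Odd k := by
  by_contra hk
  have heven : Even k := Nat.not_odd_iff_even.mp hk
  have h1 := hQ (fun y => -v₀ (-y)) (isSchwartzField_parity hv₀) (Theorems.stub_reflect_divFree v₀ hd₀)
  beta_reduce at h1
  rw [integral_parity hm hcub hwt v₀] at h1
  have hsign : ((-1 : ℝ)) ^ (k + 1) = -1 := Odd.neg_one_pow (Even.add_one heven)
  rw [hsign] at h1
  linarith

end OddMorawetzParity

/-! ### Consequences for the crux `OddMorawetzLocal` -/

open OddMorawetzParity in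
/-- **`OddMorawetzLocal` lives in odd derivative weight.** The crux is equivalent to its restriction to ODD weights
`k` (so `k ∈ {1, 3, 5}`): a witness of even weight is impossible, because the reflection `v ↦ -v(-·)` preserves
divergence-free Schwartz fields and flips the sign of `Q_m` when `k` is even (`Q_m(Pv) = (-1)^{k+1} Q_m(v)`). -/
theorem oddMorawetzLocal_iff_odd :
    Summit.NavierStokesRegularity.NavierStokesRegularity.Theses.OddMorawetz.OddMorawetzLocal ↔
      ∃ (k : ℕ) (m : EuclideanSpace ℝ (Fin 3) × (EuclideanSpace ℝ (Fin 3) [×1]→L[ℝ] EuclideanSpace ℝ (Fin 3)) × (EuclideanSpace ℝ (Fin 3) [×2]→L[ℝ] EuclideanSpace ℝ (Fin 3)) × (EuclideanSpace ℝ (Fin 3) [×3]→L[ℝ] EuclideanSpace ℝ (Fin 3)) → ℝ),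
        Odd k ∧ (let J := fun (v : EuclideanSpace ℝ (Fin 3) → EuclideanSpace ℝ (Fin 3)) (x : EuclideanSpace ℝ (Fin 3)) => (v x, iteratedFDeriv ℝ 1 v x, iteratedFDeriv ℝ 2 v x, iteratedFDeriv ℝ 3 v x); let Q := fun (v : EuclideanSpace ℝ (Fin 3) → EuclideanSpace ℝ (Fin 3)) => -∫ x, fderiv ℝ m (J v x) (J (Literature.Analysis.FluidPDE.eulerBilinear v v) x); k ≤ 5 ∧ ContDiff ℝ (⊤ : ℕ∞) m ∧ (∀ (μ : ℝ) z, m (μ • z) = μ ^ 3 * m z) ∧ (∀ (s : ℝ), 0 < s → ∀ (z₀ : EuclideanSpace ℝ (Fin 3)) (z₁ : EuclideanSpace ℝ (Fin 3) [×1]→L[ℝ] EuclideanSpace ℝ (Fin 3)) (z₂ : EuclideanSpace ℝ (Fin 3) [×2]→L[ℝ] EuclideanSpace ℝ (Fin 3)) (z₃ : EuclideanSpace ℝ (Fin 3) [×3]→L[ℝ] EuclideanSpace ℝ (Fin 3)), m (z₀, s • z₁, (s ^ 2) • z₂, (s ^ 3) • z₃) = s ^ k * m (z₀, z₁, z₂,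 z₃)) ∧ (∀ v, Literature.Analysis.FluidPDE.IsSchwartzField v → Literature.Analysis.FluidPDE.VectorCalculus.IsDivFree v → 0 ≤ Q v) ∧ (∃ v, Literature.Analysis.FluidPDE.IsSchwartzField v ∧ Literature.Analysis.FluidPDE.VectorCalculus.IsDivFree v ∧ 0 < Q v)) := by
  constructor
  · rintro ⟨k, m, h⟩
    refine ⟨k, m, ?_, h⟩
    obtain ⟨-, hm, hhom, hbi, hQ, v₀, hv₀, hd₀, hpos⟩ := h
    exact odd_of_witness hm hhom hbi hQ hv₀ hd₀ hpos
  · rintro ⟨k, m, -, h⟩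
    exact ⟨k, m, h⟩

/-- **Negative form of the parity obstruction.** `¬ OddMorawetzLocal` is equivalent to the failure of the hunt in
the ODD weights alone (`k = 1, 3, 5`): refuting the crux needs no work at even weight (`Iff.not` of
`oddMorawetzLocal_iff_odd`). -/
theorem not_oddMorawetzLocal_iff :
    ¬ Summit.NavierStokesRegularity.NavierStokesRegularity.Theses.OddMorawetz.OddMorawetzLocal ↔
      ¬ ∃ (k : ℕ) (m : EuclideanSpace ℝ (Fin 3) × (EuclideanSpace ℝ (Fin 3) [×1]→L[ℝ] EuclideanSpace ℝ (Fin 3)) × (EuclideanSpace ℝ (Fin 3) [×2]→L[ℝ] EuclideanSpace ℝ (Fin 3)) × (EuclideanSpace ℝ (Fin 3) [×3]→L[ℝ] EuclideanSpace ℝ (Fin 3)) → ℝ),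
        Odd k ∧ (let J := fun (v : EuclideanSpace ℝ (Fin 3) → EuclideanSpace ℝ (Fin 3)) (x : EuclideanSpace ℝ (Fin 3)) => (v x, iteratedFDeriv ℝ 1 v x, iteratedFDeriv ℝ 2 v x, iteratedFDeriv ℝ 3 v x); let Q := fun (v : EuclideanSpace ℝ (Fin 3) → EuclideanSpace ℝ (Fin 3)) => -∫ x, fderiv ℝ m (J v x) (J (Literature.Analysis.FluidPDE.eulerBilinear v v) x); k ≤ 5 ∧ ContDiff ℝ (⊤ : ℕ∞) m ∧ (∀ (μ : ℝ) z, m (μ • z) = μ ^ 3 * m z) ∧ (∀ (s : ℝ), 0 < s → ∀ (z₀ : EuclideanSpace ℝ (Fin 3)) (z₁ : EuclideanSpace ℝ (Fin 3) [×1]→L[ℝ] EuclideanSpace ℝ (Fin 3)) (z₂ : EuclideanSpace ℝ (Fin 3) [×2]→L[ℝ] EuclideanSpace ℝ (Fin 3)) (z₃ : EuclideanSpace ℝ (Fin 3) [×3]→L[ℝ] EuclideanSpace ℝ (Fin 3)), m (z₀, s • z₁, (s ^ 2) • z₂, (s ^ 3) • z₃) = s ^ k * m (z₀, z₁, z₂,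 z₃)) ∧ (∀ v, Literature.Analysis.FluidPDE.IsSchwartzField v → Literature.Analysis.FluidPDE.VectorCalculus.IsDivFree v → 0 ≤ Q v) ∧ (∃ v, Literature.Analysis.FluidPDE.IsSchwartzField v ∧ Literature.Analysis.FluidPDE.VectorCalculus.IsDivFree v ∧ 0 < Q v)) :=
  oddMorawetzLocal_iff_odd.not

end Summit.NavierStokesRegularity.NavierStokesRegularity.Theorems
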